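import Literature.NumberTheory.LFunctions.Zhang2022.RepairBedModuli
import Literature.NumberTheory.LFunctions.Zhang2022.SkeletonSetting
import Literature.NumberTheory.LFunctions.Zhang2022.Section17Lemma171
import Literature.NumberTheory.LFunctions.ExceptionalZeroLogDerivOne
import Literature.NumberTheory.LFunctions.KroneckerCharacterNeOne
import Literature.NumberTheory.LFunctions.Zhang2022.RepairBedScale
import Literature.NumberTheory.LFunctions.KroneckerCharacterPrimitive

/-!
# Zhang (2022) rescue bed (D-0124 (3)): the «(A)-defect ladder» quantities of bed node group 1 at an explicit
# real character `χ_D` — `L(1)`, `L′(1)`, `L″(1)`, `𝔞(D)`, the (A)-margin, the (A)-defect exponent, the Lemma 5.8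
# linearisation defect at Zhang's radius `α = π/(log|D|)⁹`, the curvature ratio `λ(D)`, split/inert heights

Topic `Literature/NumberTheory/LFunctions/Zhang2022` (Landau–Siegel audit tree; verdict-neutral), cell landau-siegel,
LS RESCUE PROTOCOL (human ruling D-0124) part (3) «GENUINE BED». Y. Zhang, *Discrete mean estimates and the
Landau–Siegel zero*, arXiv:2211.02515v1 (2022) [Zhang2022LandauSiegel] — an unrefereed manuscript under adjudication.
**Nothing here asserts or denies any of its claims; nothing here is a claim about Landau–Siegel zeros. The programme
SEARCHES and TYPES; no claim about Landau–Siegel zeros, Theorems 1–2 of arXiv:2211.02515 or a repaired Margin232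
until a kernel theorem says so.**

Source of the objects: bed-1 pre-registration `rescue/ls-rescue-bed-1/bed1-KG1-v0.1.json` (sha16 `dea02fd073922aeb`),
block `G101_A_defect_ladder` «class R (Tier G1); numbers and ratios only; NO verdict words», columns G02–G10, each a
function of the explicit real character `χ_D = kroneckerChar D` (`KroneckerCharacter.lean`) at a pre-registered
fundamental discriminant `D` (`RepairBedModuli.lean`). HONESTY (rescue/BED.md §0.2 (H2)): Assumption (A)
`‖L(1,χ_D)‖ < (log|D|)^{−2022}` is FALSE at every modulus an engine reaches; these quantities measure the «distance of
reality from the (A)-world», never a verdict on an (A)-guarded node of the manuscript.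

## What is here (typed referents; one decl per bed column)

* G02 `LOne D` (in `RepairBedModuli`); G03 `LOneDeriv D = Re L′(1,χ_D)`; G04 `LOneDeriv2 D = Re L″(1,χ_D)`;
* G05 `frakABed D` = the manuscript's normaliser `𝔞 = (6/π²) L′(1,χ)² ∏_{q∣D} q/(q+1)` (2.31) AT `χ = χ_D` — by
  definition the tree's `Lemma171.frakA (kroneckerChar D)` (`frakABed_eq`);
* G06 `aMarginLog10 D = log₁₀(L(1,χ_D)·(log|D|)^2022)` with the PROVED bridge `assumptionA_kroneckerChar_iff`:
  for non-trivial `χ_D`, `Skeleton.AssumptionA |D| χ_D ↔ LOne D < 1/(log|D|)^2022` (`L(1,χ_D)` is real and positive,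
  tree `ExceptionalZero.LFunction_one_re_pos_im_zero`), and `↔ aMarginLog10 D < 0`;
* G07 `aDefect D = −log L(1,χ_D) / log log|D|` ((A) needs `> 2022`);
* G08 `alphaZ D = π/(log|D|)⁹` (= the skeleton's `α` (2.10) at modulus `|D|`, `alphaZ_eq_skeleton_alpha`),
  `delta58 D = ‖L(1 + α_Z, χ_D) − L′(1,χ_D)·α_Z‖` (the Lemma 5.8 linearisation `L(s,χ) ≈ L′(1,χ)(s−1)` tested at
  Zhang's own radius), `rStar D = L(1,χ_D)/|L′(1,χ_D)|`;
* G09 `lambdaKE D = L″(1,χ_D)/(2 L′(1,χ_D) log|D|)` (KNIFE-EDGES R7e′ axis);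
* G10 `kroneckerValueAtPrime D p` (the integer `(D/p)`, Kronecker rule at `2`) and `leastSplitPrime D`,
  `leastInertPrime D` (`sInf`, junk `0` if none).

No `instance`, no notation; pure definitions plus the two regression/bridge theorems. `NeZero |D|` built in-term.
Rev 2 (append): `kroneckerChar_ne_one_of_mem_bed1Moduli` (an explicit inert prime per listed modulus),
`LOne_pos_of_mem_bed1Moduli`, and the hypothesis-free bridge `assumptionA_iff_of_mem_bed1Moduli` on the bed's moduli.
Rev 3 (append): DEDUP with ls-rescue-typ-2's character-side axis (`RepairBedScale`, p510623): `aDefect_eq_aExponent`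
(`aDefect D = aExponent |D| χ_D` for `χ_D ≠ 1`) and `assumptionA_iff_lt_aDefect_of_mem_bed1Moduli` (`(A) ↔ 2022 < a(D)` on the bed's moduli).
Rev 4 (append): with `χ_D` PRIMITIVE for every fundamental `D` (`KroneckerCharacterPrimitive`, p514423) the bridges
hold for ALL fundamental discriminants (`LOne_eq_norm_of_isFundamentalDiscriminant`, `assumptionA_kroneckerChar_iff_fd`),
and the summit-side statements INSTANTIATE at the bed's genuine characters: `lOneLowerBound_apply_kroneckerChar`
(`Skeleton.LOneLowerBound A` ⇒ `c₁/(log|D|)^A < LOne D` for every fundamental `D`), `theorem1_apply_kroneckerChar`, and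
`theorem1_const_lt` (any admissible constant of Theorem 1 is `< LOne D·(log|D|)^2022` at each fundamental `D`).

## References

* Y. Zhang, arXiv:2211.02515v1 (2022), §2 Assumption (A) p. 4, (2.10), (2.31); §5 Lemma 5.8 p. 11
  (`L(s,χ)` vs `L′(1,χ)(s−1)` for `α ≤ |s−1| ≤ 10α` under (A)). [cite: Zhang2022LandauSiegel, §2 (A), (2.10), (2.31); §5 Lemma 5.8]
* H. L. Montgomery, R. C. Vaughan, *Multiplicative Number Theory I* (2007), §9.3 (the Kronecker character).
  [cite: MontgomeryVaughan2007, §9.3]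
-/

noncomputable section

open Complex

namespace Literature.NumberTheory.LFunctions.Zhang2022.Repair.Bed

open Literature.NumberTheory.LFunctions.KroneckerCharacter

/-! ## `NeZero |D|` in-term and the character at `D` -/

/-- For `D ≠ 0`, `|D| ≠ 0` as a `NeZero` fact (used in-term; not an instance). [folklore] -/
private theorem neZero_natAbs {D : ℤ} (h : D ≠ 0) : NeZero D.natAbs := ⟨Int.natAbs_ne_zero.mpr h⟩

/-! ## G03–G04: derivatives of `L(s, χ_D)` at `s = 1` -/

/-- **G03** `L′(1, χ_D)` (real part; the value is real for a real character, tree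
`ExceptionalZero.deriv_LFunction_ofReal_im_eq_zero`); junk `0` at `D = 0`. [cite: Zhang2022LandauSiegel, §2 (2.31)] -/
def LOneDeriv (D : ℤ) : ℝ :=
  if h : D = 0 then 0 else
    haveI : NeZero D.natAbs := neZero_natAbs h
    (deriv (kroneckerChar D).LFunction 1).re

/-- **G04** `L″(1, χ_D)` (real part of the second derivative); junk `0` at `D = 0`.
[cite: Zhang2022LandauSiegel, §2 (2.31)] -/
def LOneDeriv2 (D : ℤ) : ℝ :=
  if h : D = 0 then 0 else
    haveI : NeZero D.natAbs := neZero_natAbs h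
    (iteratedDeriv 2 (kroneckerChar D).LFunction 1).re

/-! ## G05: the normaliser `𝔞` of (2.31) at `χ_D` -/

/-- **G05** `𝔞(D) = (6/π²)·L′(1,χ_D)²·∏_{q∣D} q/(q+1)` — the manuscript's (2.31) normalising constant evaluated at the
explicit character `χ_D`; junk `0` at `D = 0`. [cite: Zhang2022LandauSiegel, §2 (2.31)] -/
def frakABed (D : ℤ) : ℝ :=
  if h : D = 0 then 0 else
    haveI : NeZero D.natAbs := neZero_natAbs h
    Lemma171.frakA (kroneckerChar D)

/-- Regression: for `D ≠ 0`, `frakABed D` IS the tree's `Lemma171.frakA` at `χ = kroneckerChar D`, i.e.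
`(6/π²)·(Re L′(1,χ_D))²·∏_{p ∈ primeFactors |D|} p/(p+1)`. [cite: Zhang2022LandauSiegel, §2 (2.31)] -/
theorem frakABed_eq {D : ℤ} (h : D ≠ 0) :
    frakABed D = 6 / Real.pi ^ 2 * LOneDeriv D ^ 2 * ∏ p ∈ D.natAbs.primeFactors, ((p : ℝ) / (p + 1)) := by
  simp only [frakABed, LOneDeriv, dif_neg h]
  rfl

/-! ## G06–G07: the (A)-margin and the (A)-defect exponent -/

/-- **G06** the (A)-margin `m_A(D) = log₁₀(L(1,χ_D)·(log|D|)^2022)`: Assumption (A) at `χ_D` says exactly `m_A(D) < 0`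
(`assumptionA_kroneckerChar_iff_aMarginLog10`); on genuine data it is `≈ +10³`. [cite: Zhang2022LandauSiegel, §2 Assumption (A)] -/
def aMarginLog10 (D : ℤ) : ℝ := Real.logb 10 (LOne D * Real.log |(D : ℝ)| ^ 2022)

/-- **G07** the (A)-defect exponent `a(D) = −log L(1,χ_D) / log log|D|` ((A) would need `a(D) > 2022`; meaningful for
`|D| ≥ 16`, where `log log|D| > 1`). [cite: Zhang2022LandauSiegel, §2 Assumption (A)] -/
def aDefect (D : ℤ) : ℝ := -Real.log (LOne D) / Real.log (Real.log |(D : ℝ)|)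

/-- `L(1, χ_D)` is real and positive for non-trivial `χ_D`: `LOne D = ‖L(1,χ_D)‖ > 0` (tree:
`ExceptionalZero.LFunction_one_re_pos_im_zero`, with `χ_D² = 1` from `isQuadratic_kroneckerChar`).
[cite: MontgomeryVaughan2007, §9.3] -/
theorem LOne_eq_norm {D : ℤ} (hD : D ≠ 0) (h1 : @kroneckerChar D ≠ 1) :
    haveI : NeZero D.natAbs := neZero_natAbs hD
    LOne D = ‖(kroneckerChar D).LFunction 1‖ ∧ 0 < LOne D := by
  haveI : NeZero D.natAbs := neZero_natAbs hD
  have hsq : kroneckerChar D ^ 2 = 1 := (isQuadratic_kroneckerChar D).sq_eq_one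
  have h := ExceptionalZero.LFunction_one_re_pos_im_zero (kroneckerChar D) h1 hsq
  have hL : LOne D = ((kroneckerChar D).LFunction 1).re := by simp only [LOne, dif_neg hD]
  refine ⟨?_, by rw [hL]; exact h.1⟩
  rw [hL, ← Complex.re_add_im ((kroneckerChar D).LFunction 1), h.2]
  simp only [Complex.ofReal_zero, zero_mul, add_zero, Complex.norm_real, Complex.ofReal_re]
  exact (abs_of_pos h.1).symm

/-- **Bridge G06 ↔ (A).** For non-trivial `χ_D`: the manuscript's Assumption (A) at modulus `|D|` and character `χ_D`,
`Skeleton.AssumptionA |D| χ_D` (`‖L(1,χ_D)‖ < 1/(log|D|)^2022`), is literally `LOne D < 1/(log|D|)^2022`.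
[cite: Zhang2022LandauSiegel, §2 Assumption (A)] -/
theorem assumptionA_kroneckerChar_iff {D : ℤ} (hD : D ≠ 0) (h1 : @kroneckerChar D ≠ 1) :
    haveI : NeZero D.natAbs := neZero_natAbs hD
    Skeleton.AssumptionA D.natAbs (kroneckerChar D) ↔ LOne D < 1 / Real.log |(D : ℝ)| ^ 2022 := by
  haveI : NeZero D.natAbs := neZero_natAbs hD
  have hcast : ((D.natAbs : ℕ) : ℝ) = |(D : ℝ)| := by
    rw [Nat.cast_natAbs, Int.cast_abs]
  show ‖(kroneckerChar D).LFunction 1‖ < 1 / Real.log (D.natAbs : ℝ) ^ 2022 ↔ _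
  rw [(LOne_eq_norm hD h1).1, hcast]

/-- … and `↔ m_A(D) < 0` (`log₁₀` of a positive quantity is negative iff the quantity is `< 1`; `log|D| > 0` for
`|D| ≥ 2`). [cite: Zhang2022LandauSiegel, §2 Assumption (A)] -/
theorem assumptionA_kroneckerChar_iff_aMarginLog10 {D : ℤ} (hD : 2 ≤ |D|) (h1 : @kroneckerChar D ≠ 1) :
    haveI : NeZero D.natAbs := neZero_natAbs (by rintro rfl; simp at hD)
    Skeleton.AssumptionA D.natAbs (kroneckerChar D) ↔ aMarginLog10 D < 0 := by
  have hD0 : D ≠ 0 := by rintro rfl; simp at hD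
  rw [assumptionA_kroneckerChar_iff hD0 h1, aMarginLog10]
  have hpos : 0 < LOne D := (LOne_eq_norm hD0 h1).2
  have hlog : 0 < Real.log |(D : ℝ)| := by
    apply Real.log_pos
    have : (2 : ℝ) ≤ |(D : ℝ)| := by rw [← Int.cast_abs]; exact_mod_cast hD
    linarith
  have hpow : 0 < Real.log |(D : ℝ)| ^ 2022 := pow_pos hlog _
  rw [Real.logb_neg_iff (by norm_num) (mul_pos hpos hpow), lt_div_iff₀ hpow]

/-! ## G08: the Lemma 5.8 linearisation defect at Zhang's own radius -/

/-- `α_Z(D) = π/(log|D|)⁹` — the manuscript's `α = π/log P`, `P = exp 𝓛⁹` (2.6), (2.10), at modulus `|D|`.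
[cite: Zhang2022LandauSiegel, §2 (2.10)] -/
def alphaZ (D : ℤ) : ℝ := Real.pi / Real.log |(D : ℝ)| ^ 9

/-- Regression: `alphaZ D` is the skeleton's `Skeleton.alpha |D|` (`log (exp 𝓛⁹) = 𝓛⁹`). [cite: Zhang2022LandauSiegel, §2 (2.10)] -/
theorem alphaZ_eq_skeleton_alpha (D : ℤ) : alphaZ D = Skeleton.alpha D.natAbs := by
  simp only [alphaZ, Skeleton.alpha, Skeleton.bigP, Skeleton.ell, Real.log_exp, Nat.cast_natAbs, Int.cast_abs]

/-- **G08** `Δ₅₈(D) = ‖L(1 + α_Z, χ_D) − L′(1,χ_D)·α_Z‖`: the defect of the (A)-world linearisation `L(s,χ) ≈ L′(1,χ)(s−1)`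
(Lemma 5.8: `≪ 𝓛^{−15}` for `α ≤ |s−1| ≤ 10α` UNDER (A)) at the real point `s = 1 + α_Z` for the GENUINE `χ_D`
(there `L(1,χ_D) ≠ 0` dominates); junk `0` at `D = 0`. [cite: Zhang2022LandauSiegel, §5 Lemma 5.8] -/
def delta58 (D : ℤ) : ℝ :=
  if h : D = 0 then 0 else
    haveI : NeZero D.natAbs := neZero_natAbs h
    ‖(kroneckerChar D).LFunction (1 + (alphaZ D : ℂ)) - deriv (kroneckerChar D).LFunction 1 * (alphaZ D : ℂ)‖

/-- `r*(D) = L(1,χ_D)/|L′(1,χ_D)|` — the radius below which `L(s,χ_D) ≈ L′(1)(s−1)` cannot hold (the constant term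
dominates); the bed reports `r*/α_Z`. [cite: Zhang2022LandauSiegel, §5 Lemma 5.8] -/
def rStar (D : ℤ) : ℝ := LOne D / |LOneDeriv D|

/-! ## G09: the curvature ratio -/

/-- **G09** `λ(D) = L″(1,χ_D) / (2·L′(1,χ_D)·log|D|)` (the KNIFE-EDGES R7e′ axis; the bed reports `λ(D)·log|D|` against
the all-inert model value `−1.7171…`). [cite: Zhang2022LandauSiegel, §2 (2.31)] -/
def lambdaKE (D : ℤ) : ℝ := LOneDeriv2 D / (2 * LOneDeriv D * Real.log |(D : ℝ)|)

/-! ## G10: split / inert heights -/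

/-- The Kronecker value `(D/p) ∈ {0, ±1}` at a prime `p` as an INTEGER: at `p = 2` by `D mod 8` (`1 ↦ +1`, `5 ↦ −1`,
else `0`), at odd `p` the Legendre symbol (Mathlib `jacobiSym`); these are the values of `kroneckerChar D` at the
primes (`isKroneckerChar_kroneckerChar`). [cite: MontgomeryVaughan2007, §9.3] -/
def kroneckerValueAtPrime (D : ℤ) (p : ℕ) : ℤ :=
  if p = 2 then (if D % 8 = 1 then 1 else if D % 8 = 5 then -1 else 0) else jacobiSym D p

/-- **G10** `y_split(D)`: the least prime `p` with `χ_D(p) = +1` (`sInf`; junk `0` if there is none).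
[cite: LehmerLehmerShanks1970, §1] -/
def leastSplitPrime (D : ℤ) : ℕ := sInf {p : ℕ | p.Prime ∧ kroneckerValueAtPrime D p = 1}

/-- **G10** `y_inert(D)`: the least prime `p` with `χ_D(p) = −1` (`sInf`; junk `0` if there is none) — the
«(A)-mimicry height» of `D` is the largest `y` with `AllInertUpTo y D`, i.e. all primes below `y_split`… are inert.
[cite: LehmerLehmerShanks1970, §1] -/
def leastInertPrime (D : ℤ) : ℕ := sInf {p : ℕ | p.Prime ∧ kroneckerValueAtPrime D p = -1}

/-- Consistency of G10 with the ladder predicate: if all primes `p ≤ y` are inert then every prime `p ≤ y` has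
Kronecker value `−1`. [cite: LehmerLehmerShanks1970, §1] -/
theorem kroneckerValueAtPrime_eq_neg_one_of_allInertUpTo {y : ℕ} {D : ℤ} (h : AllInertUpTo y D) {p : ℕ}
    (hp : p.Prime) (hpy : p ≤ y) : kroneckerValueAtPrime D p = -1 := by
  unfold kroneckerValueAtPrime
  by_cases hp2 : p = 2
  · subst hp2
    have h8 : D % 8 = 5 := h.1 hpy
    simp [h8]
  · rw [if_neg hp2]
    exact h.2 p hp hp2 hpy

/-! ## Rev 2 (append): non-triviality of `χ_D` at every pre-registered modulus, and the hypothesis-free bridge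

For each `D` of `bed1ModuliL1a ++ bed1ModuliL1b` an explicit inert prime `p ≤ 13` (or `D ≡ 5 (mod 8)`, i.e. `2` inert)
certifies `χ_D ≠ 1` (`KroneckerCharacterNeOne`); hence `L(1,χ_D)` is real and positive and the G06 bridge
`AssumptionA |D| χ_D ↔ LOne D < 1/(log|D|)^2022 ↔ m_A(D) < 0` holds with NO side hypothesis on the bed's moduli. -/

/-- **`χ_D ≠ 1` for every pre-registered modulus** (witness: `D ≡ 5 (mod 8)` or an inert odd prime `p ∈ {3,5,7,11,13}`,
evaluated by `norm_num`). [cite: LehmerLehmerShanks1970, §1] -/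
theorem kroneckerChar_ne_one_of_mem_bed1Moduli :
    ∀ D ∈ bed1ModuliL1a ++ bed1ModuliL1b, ∀ [NeZero D.natAbs], kroneckerChar D ≠ 1 := by
  intro D hD
  have hF := isFundamentalDiscriminant_of_mem_bed1Moduli D hD
  intro _
  simp only [bed1ModuliL1a, bed1ModuliL1b, List.cons_append, List.nil_append, List.mem_cons,
    List.not_mem_nil, or_false] at hD
  rcases hD with rfl | rfl | rfl | rfl | rfl | rfl | rfl | rfl | rfl | rfl | rfl | rfl | rfl | rfl | rfl |
    rfl | rfl | rfl | rfl | rfl | rfl | rfl | rfl | rfl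
  · exact kroneckerChar_ne_one_of_emod_eight hF (by decide) -- D = -3: 2 inert
  · exact kroneckerChar_ne_one_of_jacobiSym_eq_neg_one hF Nat.prime_three (by decide) (by norm_num) -- D = -4: 3 inert
  · exact kroneckerChar_ne_one_of_jacobiSym_eq_neg_one hF Nat.prime_three (by decide) (by norm_num) -- D = -7: 3 inert
  · exact kroneckerChar_ne_one_of_jacobiSym_eq_neg_one hF Nat.prime_five (by decide) (by norm_num) -- D = -8: 5 inert
  · exact kroneckerChar_ne_one_of_emod_eight hF (by decide) -- D = -11: 2 inert
  · exact kroneckerChar_ne_one_of_emod_eight hF (by decide) -- D = -19: 2 inert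
  · exact kroneckerChar_ne_one_of_emod_eight hF (by decide) -- D = -43: 2 inert
  · exact kroneckerChar_ne_one_of_emod_eight hF (by decide) -- D = -67: 2 inert
  · exact kroneckerChar_ne_one_of_emod_eight hF (by decide) -- D = -163: 2 inert
  · exact kroneckerChar_ne_one_of_emod_eight hF (by decide) -- D = 5: 2 inert
  · exact kroneckerChar_ne_one_of_jacobiSym_eq_neg_one hF Nat.prime_three (by decide) (by norm_num) -- D = 8: 3 inert
  · exact kroneckerChar_ne_one_of_jacobiSym_eq_neg_one hF Nat.prime_five (by decide) (by norm_num) -- D = 12: 5 inert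
  · exact kroneckerChar_ne_one_of_emod_eight hF (by decide) -- D = 13: 2 inert
  · exact kroneckerChar_ne_one_of_jacobiSym_eq_neg_one hF Nat.prime_three (by decide) (by norm_num) -- D = 17: 3 inert
  · exact kroneckerChar_ne_one_of_emod_eight hF (by decide) -- D = 21: 2 inert
  · exact kroneckerChar_ne_one_of_jacobiSym_eq_neg_one hF (by norm_num : Nat.Prime 7) (by decide) (by norm_num) -- D = 24: 7 inert
  · exact kroneckerChar_ne_one_of_jacobiSym_eq_neg_one hF Nat.prime_five (by decide) (by norm_num) -- D = 28: 5 inert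
  · exact kroneckerChar_ne_one_of_emod_eight hF (by decide) -- D = 29: 2 inert
  · exact kroneckerChar_ne_one_of_jacobiSym_eq_neg_one hF (by norm_num : Nat.Prime 7) (by decide) (by norm_num) -- D = -15: 7 inert
  · exact kroneckerChar_ne_one_of_jacobiSym_eq_neg_one hF (by norm_num : Nat.Prime 11) (by decide) (by norm_num) -- D = -20: 11 inert
  · exact kroneckerChar_ne_one_of_jacobiSym_eq_neg_one hF Nat.prime_five (by decide) (by norm_num) -- D = -23: 5 inert
  · exact kroneckerChar_ne_one_of_jacobiSym_eq_neg_one hF (by norm_num : Nat.Prime 13) (by decide) (by norm_num) -- D = -24: 13 inert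
  · exact kroneckerChar_ne_one_of_emod_eight hF (by decide) -- D = -1155: 2 inert
  · exact kroneckerChar_ne_one_of_emod_eight hF (by decide) -- D = 1365: 2 inert

/-- `D ≠ 0` for the listed moduli. [cite: LehmerLehmerShanks1970, §1] -/
private theorem ne_zero_of_mem_bed1Moduli : ∀ D ∈ bed1ModuliL1a ++ bed1ModuliL1b, D ≠ 0 := by
  decide

/-- **`L(1, χ_D) > 0` at every pre-registered modulus**, `LOne D = ‖L(1,χ_D)‖`. [cite: Zhang2022LandauSiegel, §2 Assumption (A)] -/
theorem LOne_pos_of_mem_bed1Moduli : ∀ D ∈ bed1ModuliL1a ++ bed1ModuliL1b, 0 < LOne D := fun D hD =>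
  haveI : NeZero D.natAbs := neZero_natAbs (ne_zero_of_mem_bed1Moduli D hD)
  (LOne_eq_norm (ne_zero_of_mem_bed1Moduli D hD) (kroneckerChar_ne_one_of_mem_bed1Moduli D hD)).2

/-- **Hypothesis-free G06 bridge on the bed's moduli**: for every `D ∈ L1a ++ L1b`, Assumption (A) of the manuscript
at modulus `|D|` and character `χ_D` reads `LOne D < 1/(log|D|)^2022`, equivalently `m_A(D) < 0`.
[cite: Zhang2022LandauSiegel, §2 Assumption (A)] -/
theorem assumptionA_iff_of_mem_bed1Moduli :
    ∀ D ∈ bed1ModuliL1a ++ bed1ModuliL1b, ∀ [NeZero D.natAbs],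
      (Skeleton.AssumptionA D.natAbs (kroneckerChar D) ↔ LOne D < 1 / Real.log |(D : ℝ)| ^ 2022) ∧
      (Skeleton.AssumptionA D.natAbs (kroneckerChar D) ↔ aMarginLog10 D < 0) := by
  intro D hD _
  have h0 := ne_zero_of_mem_bed1Moduli D hD
  have h1 := kroneckerChar_ne_one_of_mem_bed1Moduli D hD
  have h2 : 2 ≤ |D| := by
    simp only [bed1ModuliL1a, bed1ModuliL1b, List.cons_append, List.nil_append, List.mem_cons,
      List.not_mem_nil, or_false] at hD
    rcases hD with rfl | rfl | rfl | rfl | rfl | rfl | rfl | rfl | rfl | rfl | rfl | rfl | rfl | rfl | rfl |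
      rfl | rfl | rfl | rfl | rfl | rfl | rfl | rfl | rfl <;> decide
  exact ⟨assumptionA_kroneckerChar_iff h0 h1, assumptionA_kroneckerChar_iff_aMarginLog10 h2 h1⟩

/-! ## Rev 3 (append): one quantity, one referent — `aDefect` IS typ-2's `aExponent` at `χ_D` -/

/-- **Dedup**: for non-trivial `χ_D`, the (A)-defect exponent of this file equals the character-side axis of
`RepairBedScale`: `aDefect D = aExponent |D| χ_D` (`LOne D = ‖L(1,χ_D)‖`, `(|D| : ℝ) = |D|`).
[cite: Zhang2022LandauSiegel, §2 Assumption (A)] -/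
theorem aDefect_eq_aExponent {D : ℤ} (hD : D ≠ 0) (h1 : @kroneckerChar D ≠ 1) :
    haveI : NeZero D.natAbs := neZero_natAbs hD
    aDefect D = aExponent D.natAbs (kroneckerChar D) := by
  haveI : NeZero D.natAbs := neZero_natAbs hD
  have hcast : ((D.natAbs : ℕ) : ℝ) = |(D : ℝ)| := by rw [Nat.cast_natAbs, Int.cast_abs]
  rw [aDefect, aExponent, (LOne_eq_norm hD h1).1, hcast]

/-- **(A) on the bed's axis, hypothesis-free on the pre-registered moduli**: for every `D ∈ L1a ++ L1b`,
`Skeleton.AssumptionA |D| χ_D ↔ 2022 < aDefect D` (typ-2's `assumptionA_iff_lt_aExponent` with `log|D| > 1` for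
`|D| ≥ 3` and `L(1,χ_D) ≠ 0`). [cite: Zhang2022LandauSiegel, §2 Assumption (A)] -/
theorem assumptionA_iff_lt_aDefect_of_mem_bed1Moduli :
    ∀ D ∈ bed1ModuliL1a ++ bed1ModuliL1b, ∀ [NeZero D.natAbs],
      Skeleton.AssumptionA D.natAbs (kroneckerChar D) ↔ 2022 < aDefect D := by
  intro D hD _
  have h0 := ne_zero_of_mem_bed1Moduli D hD
  have h1 := kroneckerChar_ne_one_of_mem_bed1Moduli D hD
  have h3 : 3 ≤ |D| := by
    simp only [bed1ModuliL1a, bed1ModuliL1b, List.cons_append, List.nil_append, List.mem_cons,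
      List.not_mem_nil, or_false] at hD
    rcases hD with rfl | rfl | rfl | rfl | rfl | rfl | rfl | rfl | rfl | rfl | rfl | rfl | rfl | rfl | rfl |
      rfl | rfl | rfl | rfl | rfl | rfl | rfl | rfl | rfl <;> decide
  have hlog : 1 < Real.log ((D.natAbs : ℕ) : ℝ) := by
    rw [Nat.cast_natAbs, Int.cast_abs, Real.lt_log_iff_exp_lt (by positivity)]
    have h3' : (3 : ℝ) ≤ |(D : ℝ)| := by rw [← Int.cast_abs]; exact_mod_cast h3
    have := Real.exp_one_lt_d9
    linarith
  have hL : (kroneckerChar D).LFunction 1 ≠ 0 := fun h => by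
    have := (LFunction_one_pos_of_ne_one h1).1
    rw [h, Complex.zero_re] at this
    exact lt_irrefl _ this
  rw [assumptionA_iff_lt_aExponent (kroneckerChar D) hlog hL, aDefect_eq_aExponent h0 h1]

/-! ## Rev 4 (append): bridges for EVERY fundamental discriminant; the summit-side statements at genuine `χ_D` -/

open Literature.Barriers.RiemannHypothesis (IsFundamentalDiscriminant)

/-- For every fundamental discriminant: `LOne D = ‖L(1,χ_D)‖ > 0` (`χ_D ≠ 1` by primitivity,
`KroneckerCharacter.kroneckerChar_ne_one`). [cite: MontgomeryVaughan2007, §9.3] -/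
theorem LOne_eq_norm_of_isFundamentalDiscriminant {D : ℤ} (hD : IsFundamentalDiscriminant D) [NeZero D.natAbs] :
    LOne D = ‖(kroneckerChar D).LFunction 1‖ ∧ 0 < LOne D := by
  have h0 : D ≠ 0 := fun h => by
    have := three_le_natAbs_of_isFundamentalDiscriminant hD; subst h; simp at this
  exact LOne_eq_norm h0 (kroneckerChar_ne_one hD)

/-- **Assumption (A) at a genuine character, every fundamental `D`**: `Skeleton.AssumptionA |D| χ_D ↔
LOne D < 1/(log|D|)^2022`. [cite: Zhang2022LandauSiegel, §2 Assumption (A)] -/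
theorem assumptionA_kroneckerChar_iff_fd {D : ℤ} (hD : IsFundamentalDiscriminant D) [NeZero D.natAbs] :
    Skeleton.AssumptionA D.natAbs (kroneckerChar D) ↔ LOne D < 1 / Real.log |(D : ℝ)| ^ 2022 := by
  have h0 : D ≠ 0 := fun h => by
    have := three_le_natAbs_of_isFundamentalDiscriminant hD; subst h; simp at this
  exact assumptionA_kroneckerChar_iff h0 (kroneckerChar_ne_one hD)

/-- **A lower bound of Theorem-1 shape instantiates at every genuine `χ_D`.** If `L(1,χ) > c₁(log q)^{−A}` for all real
primitive `χ` mod `q ≥ 3` (`Skeleton.LOneLowerBound A`), then for every fundamental discriminant `D`: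
`c₁/(log|D|)^A < L(1,χ_D) = LOne D` (`χ_D` is quadratic, `isQuadratic_kroneckerChar`, and primitive mod `|D| ≥ 3`,
`isPrimitive_kroneckerChar`). Kernel-checked implication; asserts neither side. [cite: Zhang2022LandauSiegel, §1 Theorem 1] -/
theorem lOneLowerBound_apply_kroneckerChar {A : ℕ} (h : Skeleton.LOneLowerBound A) :
    ∃ c₁ : ℝ, 0 < c₁ ∧ ∀ D : ℤ, IsFundamentalDiscriminant D → c₁ / Real.log |(D : ℝ)| ^ A < LOne D := by
  obtain ⟨c₁, hc₁, h⟩ := h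
  refine ⟨c₁, hc₁, fun D hD => ?_⟩
  haveI : NeZero D.natAbs := ⟨by have := three_le_natAbs_of_isFundamentalDiscriminant hD; omega⟩
  have h3 : 3 ≤ D.natAbs := three_le_natAbs_of_isFundamentalDiscriminant hD
  have hb := h D.natAbs (kroneckerChar D) h3 (isQuadratic_kroneckerChar D) (isPrimitive_kroneckerChar hD)
  have hcast : ((D.natAbs : ℕ) : ℝ) = |(D : ℝ)| := by rw [Nat.cast_natAbs, Int.cast_abs]
  rw [(LOne_eq_norm_of_isFundamentalDiscriminant hD).1, ← hcast]
  exact hb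

/-- **Theorem 1 of the manuscript, IF it held, at the bed's characters**: `∃ c₁ > 0`, `c₁/(log|D|)^2022 < LOne D` for
every fundamental `D`. A CLAIM UNDER ADJUDICATION instantiated — stated as an implication, not asserted.
[cite: Zhang2022LandauSiegel, §1 Theorem 1] -/
theorem theorem1_apply_kroneckerChar (h : Skeleton.Theorem1) :
    ∃ c₁ : ℝ, 0 < c₁ ∧ ∀ D : ℤ, IsFundamentalDiscriminant D → c₁ / Real.log |(D : ℝ)| ^ 2022 < LOne D :=
  lOneLowerBound_apply_kroneckerChar h

/-- **What genuine data says about Theorem 1's constant** (and nothing more): any `c₁` admissible in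
`Skeleton.LOneLowerBound A` satisfies `c₁ < LOne D · (log|D|)^A` at every fundamental `D` with `log|D| > 0` — each bed
value `LOne D` is an UPPER bound on the constant, never evidence for or against the statement.
[cite: Zhang2022LandauSiegel, §1 Theorem 1] -/
theorem lOneLowerBound_const_lt {A : ℕ} {c₁ : ℝ}
    (h : ∀ (q : ℕ) [NeZero q] (χ : DirichletCharacter ℂ q), 3 ≤ q → χ.IsQuadratic → χ.IsPrimitive →
      c₁ / Real.log q ^ A < ‖χ.LFunction 1‖)
    {D : ℤ} (hD : IsFundamentalDiscriminant D) : c₁ < LOne D * Real.log |(D : ℝ)| ^ A := by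
  haveI : NeZero D.natAbs := ⟨by have := three_le_natAbs_of_isFundamentalDiscriminant hD; omega⟩
  have h3 : 3 ≤ D.natAbs := three_le_natAbs_of_isFundamentalDiscriminant hD
  have hb := h D.natAbs (kroneckerChar D) h3 (isQuadratic_kroneckerChar D) (isPrimitive_kroneckerChar hD)
  have hcast : ((D.natAbs : ℕ) : ℝ) = |(D : ℝ)| := by rw [Nat.cast_natAbs, Int.cast_abs]
  rw [← (LOne_eq_norm_of_isFundamentalDiscriminant hD).1, hcast] at hb
  have hlog : 0 < Real.log |(D : ℝ)| := by
    apply Real.log_pos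
    have : (3 : ℝ) ≤ |(D : ℝ)| := by
      rw [← Int.cast_abs]; exact_mod_cast (show (3 : ℤ) ≤ |D| by rw [← Int.natCast_natAbs]; exact_mod_cast h3)
    linarith
  have hpow : 0 < Real.log |(D : ℝ)| ^ A := pow_pos hlog A
  exact (div_lt_iff₀ hpow).mp hb

end Literature.NumberTheory.LFunctions.Zhang2022.Repair.Bed

end
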